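import Summits.CriticalPhenomena.SAWScalingLimit.Theorems.SAWDefectDecoherenceBoundaryClosureRPolygonGreenLayers
import Summits.CriticalPhenomena.SAWScalingLimit.Theorems.SAWDefectDecoherenceBoundaryClosureRPolygonGreenTwisted
import HarnessLib

/-!
# Polygon Green pairing, IV: the twisted term and the remainder at one mesh, after the cover
(crux `BoundaryClosureR`, stmt-CriticalPhenomena-14004, line `polygon-parity-squeeze`, registered
stub `polygonGreenPairing`, mechanism (A1a))

At one mesh `δ`, the vertices of `Λ` whose scaled centre is close to `supp φ` are COVERED by finitely
many budget balls `B(x, r_x)`, `x ∈ t` (boundary layer budgets `δ Σ_{depth k} starMass ≤ C_x (k+1)^{3/4} Z_b`)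
and a bulk set `T` all of whose vertices are `(η₁/δ)`-deep and whose stars have scaled midpoints in a
compact `K' ⊆ Ω` controlled by `MassRatio` (`δ² Σ_{K'} Z ≤ C_MR δ^{-3/4} Z_b`).  Given this (hypotheses
`hsplit`, `hbudget`, `hMR`, `hdeep`, `hTK`), two of the three error terms of the Green identity obey:

* `bulk_starMass_le` — `(δ²/Z_b) Σ_{T} starMass ≤ 2 C_MR δ^{-3/4}`;
* `twisted_mesh_le` — `‖T_δ(ψ)‖ ≤ Σ_{x ∈ t} 6 C_x (… δ^s + … δ^{1/4}) + 12 C_MR (… δ^s + … δ^{1/4})`,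
  `s = min(θ − 3/4, 1/2)` (`DefectDecoherence` at metric depth `k` in the balls, at depth `η₁/δ` in the
  bulk; registered form `polygonGreen_twistedMesh`);
* `remainder_mesh_le` — `‖E_δ‖ ≤ (M/8)(Σ_x C_x (2R)^{7/4} + 2 C_MR) δ^{1/4}`.

The boundary part is in `…PolygonGreenBoundary.lean`; the gate case is `…GateDbarLimit.lean`.
Reference: Duminil-Copin–Smirnov, Ann. of Math. 175 (2012), §3.
-/

noncomputable section

open scoped BigOperators Topology Classical ComplexConjugate
open Filter Set Metric Complex
open Literature.Probability.LatticeModels Literature.Probability.RandomPlanarGeometry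
open Literature.Probability.RandomPlanarGeometry.SAW
open Literature.Barriers.CriticalPhenomena.HexGreen (nbrs mem_nbrs_iff)
open Summit.CriticalPhenomena.SAWScalingLimit.Theorems.PickHalfPlane
open Summit.CriticalPhenomena.SAWScalingLimit.Theorems.ObservableToSLE.FloorRatio (dist_smul_mesh)
open Summit.CriticalPhenomena.SAWScalingLimit.Theorems.DecoherenceSynthesis (norm_hexMidpoint_sub_hexCenter_le)
open Summit.CriticalPhenomena.SAWScalingLimit.Theorems.PolygonParitySqueeze.GateDbar (twisted_sum_le
  delta_sq_mul_sum_growth_le)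
open Summit.CriticalPhenomena.SAWScalingLimit.Theorems.HexObservableLimitR (greenLimit_remainder_norm_le)

namespace Summit.CriticalPhenomena.SAWScalingLimit.Theorems.PolygonParitySqueeze.PolygonGreen

/-! ### 1. The bulk: star masses over `T` via `MassRatio` -/

/-- **Bulk star masses.** If the stars of the vertices with scaled centre in `T` have scaled midpoints
in `K'` and `δ² Σᶠ_{Ω, K'} Z ≤ C_MR δ^{-3/4} Z_b`, then `(δ²/Z_b) Σ_{Λ, T} starMass ≤ 2 C_MR δ^{-3/4}`.
[cite: DuminilCopinSmirnov2012, Def. 1 (σ = 0)] -/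
theorem bulk_starMass_le {Λ : Finset HexVertex} {a b : Sym2 HexVertex} {δ CMR : ℝ} {T K' : Set ℂ}
    (hδ : 0 < δ)
    (hTK : ∀ v ∈ Λ, (δ : ℂ) * hexCenter v ∈ T → ∀ t' ∈ Λ, hexGraph.Adj v t' → (δ : ℂ) * hexMidpoint s(v, t') ∈ K')
    (hMR : δ ^ 2 * (∑ᶠ z ∈ {z : Sym2 HexVertex | z ∈ hexDomainMidEdges Λ ∧ (δ : ℂ) * hexMidpoint z ∈ K'},
        ‖hexParafermionicObservable Λ a hexCriticalFugacity 0 z‖) ≤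
      CMR * δ ^ (-(3 : ℝ) / 4) * ‖hexParafermionicObservable Λ a hexCriticalFugacity 0 b‖)
    (hZb : 0 < ‖hexParafermionicObservable Λ a hexCriticalFugacity 0 b‖) :
    δ ^ 2 / ‖hexParafermionicObservable Λ a hexCriticalFugacity 0 b‖ *
        ∑ v ∈ Λ.filter (fun v => (δ : ℂ) * hexCenter v ∈ T), starMass Λ a v ≤ 2 * CMR * δ ^ (-(3 : ℝ) / 4) := by
  set Zb := ‖hexParafermionicObservable Λ a hexCriticalFugacity 0 b‖ with hZbdef
  have h2 := sum_starMass_le_two_mul_finsum Λ a δ (fun v => (δ : ℂ) * hexCenter v ∈ T) K' hTK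
  have hz : Zb ≠ 0 := hZb.ne'
  calc δ ^ 2 / Zb * ∑ v ∈ Λ.filter (fun v => (δ : ℂ) * hexCenter v ∈ T), starMass Λ a v
      ≤ δ ^ 2 / Zb * (2 * ∑ᶠ z ∈ {z : Sym2 HexVertex | z ∈ hexDomainMidEdges Λ ∧ (δ : ℂ) * hexMidpoint z ∈ K'},
          ‖hexParafermionicObservable Λ a hexCriticalFugacity 0 z‖) := mul_le_mul_of_nonneg_left h2 (by positivity)
    _ = 2 / Zb * (δ ^ 2 * ∑ᶠ z ∈ {z : Sym2 HexVertex | z ∈ hexDomainMidEdges Λ ∧ (δ : ℂ) * hexMidpoint z ∈ K'},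
          ‖hexParafermionicObservable Λ a hexCriticalFugacity 0 z‖) := by ring
    _ ≤ 2 / Zb * (CMR * δ ^ (-(3 : ℝ) / 4) * Zb) := mul_le_mul_of_nonneg_left hMR (by positivity)
    _ = 2 * CMR * δ ^ (-(3 : ℝ) / 4) := by field_simp

/-! ### 2. The twisted term at one mesh -/

set_option maxHeartbeats 400000 in
/-- **The twisted term at one mesh, after the cover.** Data at mesh `δ` (`0 < δ ≤ min(R, η₁, 1)`):
`DefectDecoherence` with constants `(C, θ)` at `Λ` (root `a`); budget balls `B(x, r_x)`, `x ∈ t`, with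
non-negative constants `C_x` and every metric depth `≤ K ≤ R/δ`; a bulk set `T` of `(η₁/δ)`-deep vertices
whose stars are controlled by `MassRatio` with constant `C_MR`; the cover `hsplit` of the vertices
`δ/2`-close to `S ⊇ supp ψ`; `ψ` bounded by `Mψ` and `Kψ`-Lipschitz; `0 < s < 1`, `3/4 − θ ≤ −s`.  Then
`‖T_δ(ψ)‖ ≤ Σ_{x ∈ t} 6 C_x (Mψ A₀ (2R)^{1−s}/(1−s) δ^s + (Kψ/4)(2R)^{7/4} δ^{1/4})
          + 12 C_MR (Mψ max(C,0) η₁^{−θ} δ^s + (Kψ/4) δ^{1/4})`, `A₀ = max(1/2, C 2^θ)`.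
[cite: DuminilCopinSmirnov2012, §3 (summation by parts)] -/
theorem twisted_mesh_le {Λ : Finset HexVertex} {a b : Sym2 HexVertex} {δ R η₁ CMR C θ s Mψ Kψ : ℝ} {K : ℕ}
    {t : Finset ℂ} {r Cb : ℂ → ℝ} {T K' S : Set ℂ} {ψ : ℂ → ℂ}
    (hδ : 0 < δ) (hδR : δ ≤ R) (hδη₁ : δ ≤ η₁) (hδ1 : δ ≤ 1) (hKle : (K : ℝ) ≤ R / δ)
    (hdepthK : ∀ v ∈ Λ, ∀ k : ℕ, IsMetricDepth Λ v k → k ≤ K)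
    (hs0 : 0 < s) (hs1 : s < 1) (hsθ : -θ + 3 / 4 ≤ -s)
    (hDD : ∀ (v : HexVertex) (R' : ℝ), 1 ≤ R' →
      (∀ y : HexVertex, dist (hexCenter y) (hexCenter v) ≤ R' → y ∈ Λ) →
      ‖∑ t ∈ Λ.filter (fun t => hexGraph.Adj v t), conj (hexMidpoint s(v, t) - hexCenter v) *
          hexParafermionicObservable Λ a hexCriticalFugacity (5 / 8) s(v, t)‖ ≤
        C * R' ^ (-θ) * ∑ t ∈ Λ.filter (fun t => hexGraph.Adj v t),
          ‖hexParafermionicObservable Λ a hexCriticalFugacity 0 s(v, t)‖)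
    (hCb : ∀ x ∈ t, 0 ≤ Cb x)
    (hbudget : ∀ x ∈ t, ∀ k : ℕ, δ * (∑ᶠ v ∈ {v : HexVertex | v ∈ Λ ∧ (δ : ℂ) * hexCenter v ∈ ball x (r x) ∧
        IsMetricDepth Λ v k}, starMass Λ a v) ≤
      Cb x * ((k : ℝ) + 1) ^ (3 / 4 : ℝ) * ‖hexParafermionicObservable Λ a hexCriticalFugacity 0 b‖)
    (hCMR : 0 ≤ CMR)
    (hMR : δ ^ 2 * (∑ᶠ z ∈ {z : Sym2 HexVertex | z ∈ hexDomainMidEdges Λ ∧ (δ : ℂ) * hexMidpoint z ∈ K'},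
        ‖hexParafermionicObservable Λ a hexCriticalFugacity 0 z‖) ≤
      CMR * δ ^ (-(3 : ℝ) / 4) * ‖hexParafermionicObservable Λ a hexCriticalFugacity 0 b‖)
    (hdeep : ∀ v ∈ Λ, (δ : ℂ) * hexCenter v ∈ T → ∀ y : HexVertex, dist (hexCenter y) (hexCenter v) ≤ η₁ / δ → y ∈ Λ)
    (hTK : ∀ v ∈ Λ, (δ : ℂ) * hexCenter v ∈ T → ∀ t' ∈ Λ, hexGraph.Adj v t' → (δ : ℂ) * hexMidpoint s(v, t') ∈ K')
    (hsplit : ∀ v ∈ Λ, (δ : ℂ) * hexCenter v ∈ cthickening (δ / 2) S →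
      (∃ x ∈ t, (δ : ℂ) * hexCenter v ∈ ball x (r x)) ∨ (δ : ℂ) * hexCenter v ∈ T)
    (hMψ : ∀ z, ‖ψ z‖ ≤ Mψ) (hKψ : 0 ≤ Kψ) (hψL : ∀ x y, ‖ψ x - ψ y‖ ≤ Kψ * ‖x - y‖)
    (hψs : ∀ z, ψ z ≠ 0 → z ∈ S)
    (hFb : ‖hexParafermionicObservable Λ a hexCriticalFugacity (5 / 8) b‖ =
      ‖hexParafermionicObservable Λ a hexCriticalFugacity 0 b‖)
    (hZb : 0 < ‖hexParafermionicObservable Λ a hexCriticalFugacity 0 b‖) :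
    ‖∑ v ∈ Λ.filter (fun v => v.2 = 0), ∑ t ∈ Λ.filter (fun t => hexGraph.Adj v t),
        12 * (hexMidpoint s(v, t) - hexCenter v) ^ 2 * ψ ((δ : ℂ) * hexMidpoint s(v, t)) *
          ((δ : ℂ) ^ 2 * hexParafermionicObservable Λ a hexCriticalFugacity (5 / 8) s(v, t) /
            hexParafermionicObservable Λ a hexCriticalFugacity (5 / 8) b)‖ ≤
      ∑ x ∈ t, 6 * Cb x * (Mψ * max (1 / 2) (C * 2 ^ θ) * ((2 * R) ^ (1 - s) / (1 - s)) * δ ^ s +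
          Kψ / 4 * ((2 * R) ^ (7 / 4 : ℝ) * δ ^ (1 / 4 : ℝ))) +
        12 * CMR * (Mψ * max C 0 * η₁ ^ (-θ) * δ ^ s + Kψ / 4 * δ ^ (1 / 4 : ℝ)) := by
  set F : Sym2 HexVertex → ℂ := hexParafermionicObservable Λ a hexCriticalFugacity (5 / 8) with hFdef
  set Z : Sym2 HexVertex → ℂ := hexParafermionicObservable Λ a hexCriticalFugacity 0 with hZdef
  set Zb : ℝ := ‖Z b‖ with hZbdef
  set A₀ : ℝ := max (1 / 2) (C * 2 ^ θ) with hA₀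
  set C' : ℝ := max C 0 with hC'
  set Φ : HexVertex → ℝ := fun v => Mψ * ‖∑ t ∈ Λ.filter (fun t => hexGraph.Adj v t),
    conj (hexMidpoint s(v, t) - hexCenter v) * F s(v, t)‖ + Kψ * δ / 4 * starMass Λ a v with hΦ
  set wt : ℕ → ℝ := fun k => Mψ * A₀ * ((k : ℝ) + 1) ^ (-θ) + Kψ * δ / 4 with hwt
  have hMψ0 : 0 ≤ Mψ := (norm_nonneg _).trans (hMψ 0)
  have hA₀0 : 0 ≤ A₀ := le_max_of_le_left (by norm_num)
  have hstar0 : ∀ v, 0 ≤ starMass Λ a v := fun v => Finset.sum_nonneg fun t _ => norm_nonneg _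
  have hΦ0 : ∀ v, 0 ≤ Φ v := fun v =>
    add_nonneg (mul_nonneg hMψ0 (norm_nonneg _)) (mul_nonneg (by positivity) (hstar0 v))
  have hwt0 : ∀ k, 0 ≤ wt k := fun k => by
    simp only [hwt]
    have : 0 ≤ ((k : ℝ) + 1) ^ (-θ) := Real.rpow_nonneg (by positivity) _
    positivity
  have hz : Zb ≠ 0 := hZb.ne'
  -- (1) vertex reduction
  have h1 := twisted_vertex_le Λ a b hδ.le hMψ hKψ hψL hψs
  rw [hFb] at h1
  -- (2) split along the cover
  have h2 := sum_filter_le_of_cover Λ t (fun v => (δ : ℂ) * hexCenter v ∈ cthickening (δ / 2) S)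
    (fun v => (δ : ℂ) * hexCenter v ∈ T) (fun x v => (δ : ℂ) * hexCenter v ∈ ball x (r x)) Φ hΦ0 hsplit
  -- (3) the balls
  have h3 : ∀ x ∈ t, 6 * (δ ^ 2 / Zb) * ∑ v ∈ Λ.filter (fun v => (δ : ℂ) * hexCenter v ∈ ball x (r x)), Φ v ≤
      6 * Cb x * (Mψ * A₀ * ((2 * R) ^ (1 - s) / (1 - s)) * δ ^ s + Kψ / 4 * ((2 * R) ^ (7 / 4 : ℝ) * δ ^ (1 / 4 : ℝ))) := by
    intro x hx
    have hcake := layerCake_depth_le (a := a) hδ.le (hbudget x hx) hdepthK wt hwt0 Φ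
      (fun v _ k hk => twistWeight_le_of_isMetricDepth hDD hMψ0 hk)
    have hts := twisted_sum_le hδ hδR hKle hs0 hs1 hsθ (hCb x hx) hMψ0 hA₀0 hKψ (K := K)
    calc 6 * (δ ^ 2 / Zb) * ∑ v ∈ Λ.filter (fun v => (δ : ℂ) * hexCenter v ∈ ball x (r x)), Φ v
        = 6 * δ / Zb * (δ * ∑ v ∈ Λ.filter (fun v => (δ : ℂ) * hexCenter v ∈ ball x (r x)), Φ v) := by ring
      _ ≤ 6 * δ / Zb * (Cb x * Zb * ∑ k ∈ Finset.range (K + 1), wt k * ((k : ℝ) + 1) ^ (3 / 4 : ℝ)) :=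
          mul_le_mul_of_nonneg_left hcake (by positivity)
      _ = 6 * Cb x * δ * ∑ k ∈ Finset.range (K + 1), wt k * ((k : ℝ) + 1) ^ (3 / 4 : ℝ) := by
          field_simp
      _ = 6 * Cb x * δ * ∑ k ∈ Finset.range (K + 1),
            (Mψ * A₀ * ((k : ℝ) + 1) ^ (-θ) + Kψ * δ / 4) * ((k : ℝ) + 1) ^ (3 / 4 : ℝ) := by
          simp only [hwt]
      _ ≤ _ := hts
  -- (4) the bulk
  have hR1 : 1 ≤ η₁ / δ := by rw [le_div_iff₀ hδ]; linarith
  have h4 : 6 * (δ ^ 2 / Zb) * ∑ v ∈ Λ.filter (fun v => (δ : ℂ) * hexCenter v ∈ T), Φ v ≤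
      12 * CMR * (Mψ * C' * η₁ ^ (-θ) * δ ^ s + Kψ / 4 * δ ^ (1 / 4 : ℝ)) := by
    have hcoef : ∑ v ∈ Λ.filter (fun v => (δ : ℂ) * hexCenter v ∈ T), Φ v ≤
        (Mψ * C' * (η₁ / δ) ^ (-θ) + Kψ * δ / 4) * ∑ v ∈ Λ.filter (fun v => (δ : ℂ) * hexCenter v ∈ T), starMass Λ a v := by
      rw [Finset.mul_sum]
      refine Finset.sum_le_sum fun v hv => ?_
      obtain ⟨hvΛ, hvT⟩ := Finset.mem_filter.1 hv
      refine (twistWeight_le_of_deep hDD hMψ0 hR1 (hdeep v hvΛ hvT) (L := Kψ) (δ := δ)).trans ?_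
      refine mul_le_mul_of_nonneg_right ?_ (hstar0 v)
      have hρ : 0 ≤ (η₁ / δ) ^ (-θ) := Real.rpow_nonneg (by positivity) _
      nlinarith [mul_le_mul_of_nonneg_left (mul_le_mul_of_nonneg_right (le_max_left C 0) hρ) hMψ0]
    have hbulk := bulk_starMass_le (a := a) (b := b) hδ hTK hMR hZb
    have hpow1 : (η₁ / δ) ^ (-θ) = η₁ ^ (-θ) * δ ^ θ := by
      rw [Real.div_rpow (by linarith) hδ.le, Real.rpow_neg hδ.le, div_inv_eq_mul]
    have hpow2 : δ ^ θ * δ ^ (-(3 : ℝ) / 4) ≤ δ ^ s := by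
      rw [← Real.rpow_add hδ]
      exact Real.rpow_le_rpow_of_exponent_ge hδ hδ1 (by linarith)
    have hpow3 : δ * δ ^ (-(3 : ℝ) / 4) = δ ^ (1 / 4 : ℝ) := by
      have e : δ * δ ^ (-(3 : ℝ) / 4) = δ ^ (1 : ℝ) * δ ^ (-(3 : ℝ) / 4) := by rw [Real.rpow_one]
      rw [e, ← Real.rpow_add hδ]; norm_num
    have hcoef0 : 0 ≤ Mψ * C' * (η₁ / δ) ^ (-θ) + Kψ * δ / 4 := by
      have : 0 ≤ (η₁ / δ) ^ (-θ) := Real.rpow_nonneg (by positivity) _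
      have : 0 ≤ C' := le_max_right _ _
      positivity
    calc 6 * (δ ^ 2 / Zb) * ∑ v ∈ Λ.filter (fun v => (δ : ℂ) * hexCenter v ∈ T), Φ v
        ≤ 6 * (δ ^ 2 / Zb) * ((Mψ * C' * (η₁ / δ) ^ (-θ) + Kψ * δ / 4) *
            ∑ v ∈ Λ.filter (fun v => (δ : ℂ) * hexCenter v ∈ T), starMass Λ a v) :=
          mul_le_mul_of_nonneg_left hcoef (by positivity)
      _ = 6 * (Mψ * C' * (η₁ / δ) ^ (-θ) + Kψ * δ / 4) *
            (δ ^ 2 / Zb * ∑ v ∈ Λ.filter (fun v => (δ : ℂ) * hexCenter v ∈ T), starMass Λ a v) := by ring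
      _ ≤ 6 * (Mψ * C' * (η₁ / δ) ^ (-θ) + Kψ * δ / 4) * (2 * CMR * δ ^ (-(3 : ℝ) / 4)) :=
          mul_le_mul_of_nonneg_left hbulk (by positivity)
      _ = 12 * CMR * (Mψ * C' * η₁ ^ (-θ) * (δ ^ θ * δ ^ (-(3 : ℝ) / 4)) + Kψ / 4 * (δ * δ ^ (-(3 : ℝ) / 4))) := by
          rw [hpow1]; ring
      _ ≤ 12 * CMR * (Mψ * C' * η₁ ^ (-θ) * δ ^ s + Kψ / 4 * δ ^ (1 / 4 : ℝ)) := by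
          rw [hpow3]
          have hC'0 : 0 ≤ C' := le_max_right _ _
          have : 0 ≤ η₁ ^ (-θ) := Real.rpow_nonneg (by linarith) _
          gcongr
  -- combine
  calc _ ≤ 6 * (δ ^ 2 / Zb) * ∑ v ∈ Λ.filter (fun v => (δ : ℂ) * hexCenter v ∈ cthickening (δ / 2) S), Φ v := h1
    _ ≤ 6 * (δ ^ 2 / Zb) * (∑ x ∈ t, ∑ v ∈ Λ.filter (fun v => (δ : ℂ) * hexCenter v ∈ ball x (r x)), Φ v +
          ∑ v ∈ Λ.filter (fun v => (δ : ℂ) * hexCenter v ∈ T), Φ v) := mul_le_mul_of_nonneg_left h2 (by positivity)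
    _ = ∑ x ∈ t, 6 * (δ ^ 2 / Zb) * ∑ v ∈ Λ.filter (fun v => (δ : ℂ) * hexCenter v ∈ ball x (r x)), Φ v +
          6 * (δ ^ 2 / Zb) * ∑ v ∈ Λ.filter (fun v => (δ : ℂ) * hexCenter v ∈ T), Φ v := by
        rw [mul_add, Finset.mul_sum]
    _ ≤ _ := add_le_add (Finset.sum_le_sum h3) h4

/-! ### 3. The Taylor remainder at one mesh -/

/-- **The Taylor remainder at one mesh, after the cover.** With the symmetric second-order Taylor
constant `M` of `φ`, a remainder radius `re ≥ δ`, and the cover `hsplit` of the vertices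
`(re + δ/2)`-close to `supp φ`:  `‖E_δ‖ ≤ (M/8)(Σ_{x ∈ t} C_x (2R)^{7/4} + 2 C_MR) δ^{1/4}`.
[cite: DuminilCopinSmirnov2012, §3 (summation by parts)] -/
theorem remainder_mesh_le {Λ : Finset HexVertex} {a b : Sym2 HexVertex} {δ R CMR M re : ℝ} {K : ℕ}
    {t : Finset ℂ} {r Cb : ℂ → ℝ} {T K' : Set ℂ} {φ : ℂ → ℂ}
    (hδ : 0 < δ) (hδR : δ ≤ R) (hKle : (K : ℝ) ≤ R / δ)
    (hdepthK : ∀ v ∈ Λ, ∀ k : ℕ, IsMetricDepth Λ v k → k ≤ K)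
    (hCb : ∀ x ∈ t, 0 ≤ Cb x)
    (hbudget : ∀ x ∈ t, ∀ k : ℕ, δ * (∑ᶠ v ∈ {v : HexVertex | v ∈ Λ ∧ (δ : ℂ) * hexCenter v ∈ ball x (r x) ∧
        IsMetricDepth Λ v k}, starMass Λ a v) ≤
      Cb x * ((k : ℝ) + 1) ^ (3 / 4 : ℝ) * ‖hexParafermionicObservable Λ a hexCriticalFugacity 0 b‖)
    (hMR : δ ^ 2 * (∑ᶠ z ∈ {z : Sym2 HexVertex | z ∈ hexDomainMidEdges Λ ∧ (δ : ℂ) * hexMidpoint z ∈ K'},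
        ‖hexParafermionicObservable Λ a hexCriticalFugacity 0 z‖) ≤
      CMR * δ ^ (-(3 : ℝ) / 4) * ‖hexParafermionicObservable Λ a hexCriticalFugacity 0 b‖)
    (hTK : ∀ v ∈ Λ, (δ : ℂ) * hexCenter v ∈ T → ∀ t' ∈ Λ, hexGraph.Adj v t' → (δ : ℂ) * hexMidpoint s(v, t') ∈ K')
    (hre : δ ≤ re)
    (hsplit : ∀ v ∈ Λ, (δ : ℂ) * hexCenter v ∈ cthickening (re + δ / 2) (tsupport φ) →
      (∃ x ∈ t, (δ : ℂ) * hexCenter v ∈ ball x (r x)) ∨ (δ : ℂ) * hexCenter v ∈ T)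
    (hM0 : 0 ≤ M) (hM : ∀ z h : ℂ, ‖φ (z + h) - φ (z - h) - 2 * fderiv ℝ φ z h‖ ≤ M * ‖h‖ ^ 2)
    (hFb : ‖hexParafermionicObservable Λ a hexCriticalFugacity (5 / 8) b‖ =
      ‖hexParafermionicObservable Λ a hexCriticalFugacity 0 b‖)
    (hZb : 0 < ‖hexParafermionicObservable Λ a hexCriticalFugacity 0 b‖) :
    ‖∑ v ∈ Λ.filter (fun v => v.2 = 0), ∑ t ∈ Λ.filter (fun t => hexGraph.Adj v t),
        (φ ((δ : ℂ) * hexCenter t) - φ ((δ : ℂ) * hexCenter v) -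
            2 * fderiv ℝ φ ((δ : ℂ) * hexMidpoint s(v, t)) ((δ : ℂ) * (hexMidpoint s(v, t) - hexCenter v))) *
          (hexMidpoint s(v, t) - hexCenter v) *
          ((δ : ℂ) * hexParafermionicObservable Λ a hexCriticalFugacity (5 / 8) s(v, t) /
            hexParafermionicObservable Λ a hexCriticalFugacity (5 / 8) b)‖ ≤
      M / 8 * (∑ x ∈ t, Cb x * (2 * R) ^ (7 / 4 : ℝ) + 2 * CMR) * δ ^ (1 / 4 : ℝ) := by
  set F : Sym2 HexVertex → ℂ := hexParafermionicObservable Λ a hexCriticalFugacity (5 / 8) with hFdef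
  set Z : Sym2 HexVertex → ℂ := hexParafermionicObservable Λ a hexCriticalFugacity 0 with hZdef
  set Zb : ℝ := ‖Z b‖ with hZbdef
  have hz : Zb ≠ 0 := hZb.ne'
  have hstar0 : ∀ v, 0 ≤ starMass Λ a v := fun v => Finset.sum_nonneg fun t _ => norm_nonneg _
  have hre0 : 0 ≤ re := hδ.le.trans hre
  -- (1) remainder ≤ (M/8) δ · mass near the support; mass ≤ (δ²/Zb) Σ starMass
  have hrem := greenLimit_remainder_norm_le Λ F (F b) φ hδ hre hM0 hM
  have hind := remainder_vertex_le Λ a b (tsupport φ) hδ.le hre0 (r := re)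
  rw [hFb] at hind
  -- (2) split
  have h2 := sum_filter_le_of_cover Λ t (fun v => (δ : ℂ) * hexCenter v ∈ cthickening (re + δ / 2) (tsupport φ))
    (fun v => (δ : ℂ) * hexCenter v ∈ T) (fun x v => (δ : ℂ) * hexCenter v ∈ ball x (r x))
    (fun v => starMass Λ a v) hstar0 hsplit
  -- (3) balls
  have h3 : ∀ x ∈ t, δ * (δ ^ 2 / Zb * ∑ v ∈ Λ.filter (fun v => (δ : ℂ) * hexCenter v ∈ ball x (r x)), starMass Λ a v) ≤
      Cb x * (2 * R) ^ (7 / 4 : ℝ) * δ ^ (1 / 4 : ℝ) := by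
    intro x hx
    have hcake := layerCake_depth_le (a := a) hδ.le (hbudget x hx) hdepthK (fun _ => (1 : ℝ)) (fun _ => zero_le_one)
      (fun v => starMass Λ a v) (fun v _ k _ => by rw [one_mul])
    have hgro := delta_sq_mul_sum_growth_le hδ hδR hKle
    simp only [one_mul] at hcake
    calc δ * (δ ^ 2 / Zb * ∑ v ∈ Λ.filter (fun v => (δ : ℂ) * hexCenter v ∈ ball x (r x)), starMass Λ a v)
        = δ ^ 2 / Zb * (δ * ∑ v ∈ Λ.filter (fun v => (δ : ℂ) * hexCenter v ∈ ball x (r x)), starMass Λ a v) := by ring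
      _ ≤ δ ^ 2 / Zb * (Cb x * Zb * ∑ k ∈ Finset.range (K + 1), ((k : ℝ) + 1) ^ (3 / 4 : ℝ)) :=
          mul_le_mul_of_nonneg_left hcake (by positivity)
      _ = Cb x * (δ ^ 2 * ∑ k ∈ Finset.range (K + 1), ((k : ℝ) + 1) ^ (3 / 4 : ℝ)) := by field_simp
      _ ≤ Cb x * ((2 * R) ^ (7 / 4 : ℝ) * δ ^ (1 / 4 : ℝ)) := mul_le_mul_of_nonneg_left hgro (hCb x hx)
      _ = Cb x * (2 * R) ^ (7 / 4 : ℝ) * δ ^ (1 / 4 : ℝ) := by ring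
  -- (4) bulk
  have h4 : δ * (δ ^ 2 / Zb * ∑ v ∈ Λ.filter (fun v => (δ : ℂ) * hexCenter v ∈ T), starMass Λ a v) ≤
      2 * CMR * δ ^ (1 / 4 : ℝ) := by
    have hbulk := bulk_starMass_le (a := a) (b := b) hδ hTK hMR hZb
    have hpow3 : δ * δ ^ (-(3 : ℝ) / 4) = δ ^ (1 / 4 : ℝ) := by
      have e : δ * δ ^ (-(3 : ℝ) / 4) = δ ^ (1 : ℝ) * δ ^ (-(3 : ℝ) / 4) := by rw [Real.rpow_one]
      rw [e, ← Real.rpow_add hδ]; norm_num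
    calc δ * (δ ^ 2 / Zb * ∑ v ∈ Λ.filter (fun v => (δ : ℂ) * hexCenter v ∈ T), starMass Λ a v)
        ≤ δ * (2 * CMR * δ ^ (-(3 : ℝ) / 4)) := mul_le_mul_of_nonneg_left hbulk hδ.le
      _ = 2 * CMR * (δ * δ ^ (-(3 : ℝ) / 4)) := by ring
      _ = 2 * CMR * δ ^ (1 / 4 : ℝ) := by rw [hpow3]
  -- combine
  calc _ ≤ M / 8 * δ * ∑ v ∈ Λ.filter (fun v => v.2 = 0), ∑ t ∈ Λ.filter (fun t => hexGraph.Adj v t),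
        (cthickening re (tsupport φ)).indicator (fun _ => ‖(δ : ℂ) ^ 2 * F s(v, t) / F b‖)
          ((δ : ℂ) * hexMidpoint s(v, t)) := hrem
    _ ≤ M / 8 * δ * (δ ^ 2 / Zb * ∑ v ∈ Λ.filter (fun v =>
          (δ : ℂ) * hexCenter v ∈ cthickening (re + δ / 2) (tsupport φ)), starMass Λ a v) :=
        mul_le_mul_of_nonneg_left hind (by positivity)
    _ ≤ M / 8 * δ * (δ ^ 2 / Zb * (∑ x ∈ t, ∑ v ∈ Λ.filter (fun v => (δ : ℂ) * hexCenter v ∈ ball x (r x)),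
          starMass Λ a v + ∑ v ∈ Λ.filter (fun v => (δ : ℂ) * hexCenter v ∈ T), starMass Λ a v)) :=
        mul_le_mul_of_nonneg_left (mul_le_mul_of_nonneg_left h2 (by positivity)) (by positivity)
    _ = M / 8 * (δ * (δ ^ 2 / Zb * (∑ x ∈ t, ∑ v ∈ Λ.filter (fun v => (δ : ℂ) * hexCenter v ∈ ball x (r x)),
          starMass Λ a v + ∑ v ∈ Λ.filter (fun v => (δ : ℂ) * hexCenter v ∈ T), starMass Λ a v))) := by ring
    _ = M / 8 * (∑ x ∈ t, δ * (δ ^ 2 / Zb * ∑ v ∈ Λ.filter (fun v => (δ : ℂ) * hexCenter v ∈ ball x (r x)),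
          starMass Λ a v) + δ * (δ ^ 2 / Zb * ∑ v ∈ Λ.filter (fun v => (δ : ℂ) * hexCenter v ∈ T), starMass Λ a v)) := by
        congr 1
        rw [mul_add, Finset.mul_sum, mul_add, Finset.mul_sum]
    _ ≤ M / 8 * (∑ x ∈ t, Cb x * (2 * R) ^ (7 / 4 : ℝ) * δ ^ (1 / 4 : ℝ) + 2 * CMR * δ ^ (1 / 4 : ℝ)) :=
        mul_le_mul_of_nonneg_left (add_le_add (Finset.sum_le_sum h3) h4) (by positivity)
    _ = M / 8 * (∑ x ∈ t, Cb x * (2 * R) ^ (7 / 4 : ℝ) + 2 * CMR) * δ ^ (1 / 4 : ℝ) := by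
        rw [← Finset.sum_mul]; ring

/-! ### Registered form (sub-goal of `polygonGreenPairing`) -/

/-- **Registered sub-goal `polygonGreen_twistedMesh`** (crux item stmt-CriticalPhenomena-14004, line
`polygon-parity-squeeze`, stub `polygonGreenPairing`, mechanism (A1a)): registry form (one `∀`-term) of
`twisted_mesh_le` — the twisted term at one mesh after the cover, from `DefectDecoherence`, the layer
budgets and `MassRatio`. [cite: DuminilCopinSmirnov2012, §3 (summation by parts)] -/
theorem polygonGreen_twistedMesh : ∀ (Λ : Finset HexVertex) (a b : Sym2 HexVertex) (δ R η₁ CMR C θ s Mψ Kψ : ℝ) (K : ℕ) (t : Finset ℂ) (r Cb : ℂ → ℝ) (T K' S : Set ℂ) (ψ : ℂ → ℂ), 0 < δ → δ ≤ R → δ ≤ η₁ → δ ≤ 1 → (K : ℝ) ≤ R / δ → (∀ v ∈ Λ, ∀ k : ℕ, IsMetricDepth Λ v k → k ≤ K) → 0 < s → s < 1 → -θ + 3 / 4 ≤ -s → (∀ (v : HexVertex) (R' : ℝ), 1 ≤ R' → (∀ y : HexVertex, dist (hexCenter y) (hexCenter v) ≤ R' → y ∈ Λ) → ‖∑ t ∈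 Λ.filter (fun t => hexGraph.Adj v t), (starRingEnd ℂ) (hexMidpoint s(v, t) - hexCenter v) * hexParafermionicObservable Λ a hexCriticalFugacity (5 / 8) s(v, t)‖ ≤ C * R' ^ (-θ) * ∑ t ∈ Λ.filter (fun t => hexGraph.Adj v t), ‖hexParafermionicObservable Λ a hexCriticalFugacity 0 s(v, t)‖) → (∀ x ∈ t, 0 ≤ Cb x) → (∀ x ∈ t, ∀ k : ℕ, δ * (∑ᶠ v ∈ {v : HexVertex | v ∈ Λ ∧ (δ : ℂ) * hexCenter v ∈ Metric.ball x (r x) ∧ IsMetricDepth Λ v k}, starMass Λ a v) ≤ Cb x * ((k : ℝ) + 1) ^ (3 / 4 : ℝ) * ‖hexParafermionicObservable Λ a hexCriticalFugacity 0 b‖) → 0 ≤ CMR → δ ^ 2 * (∑ᶠ z ∈ {z : Sym2 HexVertex | z ∈ hexDomainMidEdges Λ ∧ (δ : ℂ) * hexMidpoint z ∈ K'}, ‖hexParafermionicObservable Λ a hexCriticalFugacity 0 z‖) ≤ CMR * δ ^ (-(3 : ℝ) / 4) * ‖hexParafermionicObservable Λ a hexCriticalFugacity 0 b‖ → (∀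 v ∈ Λ, (δ : ℂ) * hexCenter v ∈ T → ∀ y : HexVertex, dist (hexCenter y) (hexCenter v) ≤ η₁ / δ → y ∈ Λ) → (∀ v ∈ Λ, (δ : ℂ) * hexCenter v ∈ T → ∀ t' ∈ Λ, hexGraph.Adj v t' → (δ : ℂ) * hexMidpoint s(v, t') ∈ K') → (∀ v ∈ Λ, (δ : ℂ) * hexCenter v ∈ Metric.cthickening (δ / 2) S → (∃ x ∈ t, (δ : ℂ) * hexCenter v ∈ Metric.ball x (r x)) ∨ (δ : ℂ) * hexCenter v ∈ T) → (∀ z, ‖ψ z‖ ≤ Mψ) → 0 ≤ Kψ → (∀ x y, ‖ψ x - ψ y‖ ≤ Kψ * ‖x - y‖) → (∀ z, ψ z ≠ 0 → z ∈ S) → ‖hexParafermionicObservable Λ a hexCriticalFugacity (5 / 8) b‖ = ‖hexParafermionicObservable Λ a hexCriticalFugacity 0 b‖ → 0 < ‖hexParafermionicObservable Λ a hexCriticalFugacity 0 b‖ → ‖∑ v ∈ Λ.filter (fun v => v.2 = 0), ∑ t ∈ Λ.filter (fun t => hexGraph.Adj v t), 12 * (hexMidpoint s(v, t) - hexCenter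 v) ^ 2 * ψ ((δ : ℂ) * hexMidpoint s(v, t)) * ((δ : ℂ) ^ 2 * hexParafermionicObservable Λ a hexCriticalFugacity (5 / 8) s(v, t) / hexParafermionicObservable Λ a hexCriticalFugacity (5 / 8) b)‖ ≤ ∑ x ∈ t, 6 * Cb x * (Mψ * max (1 / 2) (C * 2 ^ θ) * ((2 * R) ^ (1 - s) / (1 - s)) * δ ^ s + Kψ / 4 * ((2 * R) ^ (7 / 4 : ℝ) * δ ^ (1 / 4 : ℝ))) + 12 * CMR * (Mψ * max C 0 * η₁ ^ (-θ) * δ ^ s + Kψ / 4 * δ ^ (1 / 4 : ℝ)) :=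
  fun _ _ _ _ _ _ _ _ _ _ _ _ _ _ _ _ _ _ _ _ hδ hδR hδη₁ hδ1 hKle hdepthK hs0 hs1 hsθ hDD hCb hbudget hCMR hMR hdeep hTK hsplit hMψ hKψ hψL hψs hFb hZb =>
    twisted_mesh_le hδ hδR hδη₁ hδ1 hKle hdepthK hs0 hs1 hsθ hDD hCb hbudget hCMR hMR hdeep hTK hsplit hMψ hKψ hψL hψs hFb hZb

end Summit.CriticalPhenomena.SAWScalingLimit.Theorems.PolygonParitySqueeze.PolygonGreen

end
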